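import Summits.AtomisticToContinuum.HydrodynamicLimit.Theorems.StiffCollisionalRelaxationAprioriBoundsFibreDefs
import Summits.AtomisticToContinuum.HydrodynamicLimit.Theorems.StiffCollisionalRelaxationAprioriBoundsVelocityTailsOfGaussianVelocityTails
import Summits.AtomisticToContinuum.HydrodynamicLimit.Theorems.StiffCollisionalRelaxationAprioriBoundsVelocityTailsHomogeneous
import Summits.AtomisticToContinuum.HydrodynamicLimit.Theorems.StiffCollisionalRelaxationAprioriBoundsPartOneChain
import Literature.Barriers.AtomisticToContinuum.HighMomentumCutoff
import HarnessLib

/-!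
# The far-tail occupation input `FarTailAt` from Gaussian velocity tails in the mean
(line `fibre-deficit-transfer`, crux `StiffCollisionalRelaxation.AprioriBounds` =
`CollisionIsometryCLT.AprioriBoundsPreShock`, stmt-AtomisticToContinuum-14827; stub `stub_farTail`)

Supporting file (`--supports stmt-AtomisticToContinuum-14827`) of the lead prover
`prover-line-stmt-AtomisticToContinuum-14827-a1-0` (skeleton r2).  The registered stub `stub_farTail` asks, under
the crux prefix (profiles → `∃ σ₀ ∃ η₁ ∀ σ < σ₀` → classical hs-Euler solution on `[0, T)` → flow family with the
`t = 0` LLN → `0 < t < T` with the chamber `2ρσ³ < η₁` on `[0, t]`), for the FAR-TAIL OCCUPATION package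
`FarTailAt σ a₀ θ₀ u₀ Φ t` of the line's vocabulary (`Theorems.FibreDeficitTransfer`, landed Defs): the EXPECTED
time-integrated one-particle occupation of the velocity levels `K ≥ K₀ log(N+2)`,
`E_N ∫₀ᵗ frac_K(Φ_s z) ds`, is at most `t·A·(N+1)^r·e^{−K/(2Θ)}`.  This is an OPEN dynamical input (chaos-lite);
this file records what the tree already offers towards it.

* `frac_le_exp_neg_mul_avg`, `ofReal_frac_le_expVelocityMoment` — MARKOV AT ONE CONFIGURATION:
  `frac_K(w) ≤ e^{−cK}·(N+1)⁻¹∑ᵢ e^{c|vᵢ|²}` for `c ≥ 0` and every `K ∈ ℝ`.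
* `farTailAt_of_expVelocityMoment` — THE REDUCTION (Markov + Tonelli along the flow): an expected Gaussian
  velocity moment at rate `c > 0` along the flow family, `E_{P_N} expVelocityMoment c (Φ_N(s) ·) ≤ C < ⊤` for
  `N ≥ N₀`, `s ∈ [0, t]`, gives `FarTailAt σ a₀ θ₀ u₀ Φ t` with `Θ := 1/(2c)`, `A := C.toReal`, `r := 0`,
  `K₀ := 0` and the same `N₀` — for ANY `σ`, profiles and flows (the local Gibbs law is s-finite and carried by
  the good set, where the flow is jointly measurable: `AdiabatCeiling.aemeasurable_comp_flow_prod₂`).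
* `farTail_of_gaussianVelocityTails` (REGISTERED sub-goal) — hence the route item
  `SpeedCapSurgery.GaussianVelocityTails` (stmt-AtomisticToContinuum-9633, open; = the body of the barrier file's
  `HighMomentumCutoff σ` with the conjunct's closure) implies the statement of `stub_farTail` VERBATIM, through the
  landed dock `AdiabatCeiling.stub_velocityTails_of_gaussianVelocityTails`.
* `farTail_of_highMomentumCutoff` — the same from `HighMomentumCutoff σ` for all small `σ`
  (`AdiabatCeiling.velocityTails_of_highMomentumCutoff`).
* `farTail_homogeneous` — the EQUILIBRIUM INSTANCE of `stub_farTail`, PROVED for every flow family: at the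
  homogeneous profiles `(a₀, u₀, θ₀) = (1, 0, θ₀)` the landed `AdiabatCeiling.velocityTails_homogeneous` supplies
  the expected Gaussian moment, so `FarTailAt` holds with `r = 0` under the crux prefix.

No new definitions, no named facts; axioms `propext`, `Classical.choice`, `Quot.sound`.
-/

noncomputable section

open MeasureTheory Filter Set Topology
open scoped ENNReal

namespace Summit.AtomisticToContinuum.HydrodynamicLimit.Theorems.FibreDeficitTransfer

open Literature.MathematicalPhysics.KineticTheory Literature.Analysis.FluidPDE
open Summit.AtomisticToContinuum.HydrodynamicLimit.Theorems.AprioriBoundsNegative (PartOneAt PartTwoAt)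
open Summit.AtomisticToContinuum.HydrodynamicLimit.Theorems.VisitLedgerUpscattering (Cfg Flow Flows NiceProfiles)
open Literature.Barriers.AtomisticToContinuum (expVelocityMoment HighMomentumCutoff)

/-! ## Markov at one configuration -/

/-- MARKOV AT ONE CONFIGURATION: for `c ≥ 0` and every level `K ∈ ℝ`,
`frac_K(w) ≤ e^{−cK} · (N+1)⁻¹ ∑ᵢ e^{c|vᵢ|²}` (termwise `𝟙{K ≤ |v|²} ≤ e^{c(|v|² − K)}`). -/
theorem frac_le_exp_neg_mul_avg {N : ℕ} {c : ℝ} (hc : 0 ≤ c) (K : ℝ) (w : Cfg N) :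
    frac K w ≤ Real.exp (-(c * K)) * (((N + 1 : ℕ) : ℝ)⁻¹ * ∑ i, Real.exp (c * ‖(w i).2‖ ^ 2)) := by
  rw [frac_eq_avg]
  calc ((N + 1 : ℕ) : ℝ)⁻¹ * ∑ i, (if K ≤ ‖(w i).2‖ ^ 2 then (1 : ℝ) else 0)
      ≤ ((N + 1 : ℕ) : ℝ)⁻¹ * ∑ i, Real.exp (-(c * K)) * Real.exp (c * ‖(w i).2‖ ^ 2) := by
        refine mul_le_mul_of_nonneg_left (Finset.sum_le_sum fun i _ => ?_) (inv_nonneg.2 (Nat.cast_nonneg _))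
        split_ifs with h
        · rw [← Real.exp_add]
          exact Real.one_le_exp (by nlinarith)
        · exact mul_nonneg (Real.exp_pos _).le (Real.exp_pos _).le
    _ = Real.exp (-(c * K)) * (((N + 1 : ℕ) : ℝ)⁻¹ * ∑ i, Real.exp (c * ‖(w i).2‖ ^ 2)) := by
        rw [← Finset.mul_sum, mul_left_comm]

/-- The same inequality in `ℝ≥0∞`, against the barrier file's observable `expVelocityMoment c w =
ofReal ((N+1)⁻¹ ∑ᵢ e^{c|vᵢ|²})`: `ofReal (frac_K w) ≤ ofReal (e^{−cK}) · expVelocityMoment c w`. -/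
theorem ofReal_frac_le_expVelocityMoment {N : ℕ} {c : ℝ} (hc : 0 ≤ c) (K : ℝ) (w : Cfg N) :
    ENNReal.ofReal (frac K w) ≤ ENNReal.ofReal (Real.exp (-(c * K))) * expVelocityMoment c w := by
  rw [Literature.Barriers.AtomisticToContinuum.expVelocityMoment_eq,
    ← ENNReal.ofReal_mul (Real.exp_pos _).le]
  exact ENNReal.ofReal_le_ofReal (frac_le_exp_neg_mul_avg hc K w)

/-! ## The reduction: `FarTailAt` from an expected Gaussian moment along the flow -/

/-- **`FarTailAt` FROM AN EXPECTED GAUSSIAN VELOCITY MOMENT ALONG THE FLOW** (Markov + Tonelli).  For any `σ`,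
profiles, flow family `Φ`, horizon `t`, rate `c > 0`, constant `C < ⊤` and threshold `N₀`: if
`∫⁻ expVelocityMoment c (Φ_N(s) z) dλ^N ≤ C` for all `N ≥ N₀` and `s ∈ [0, t]`, then `FarTailAt σ a₀ θ₀ u₀ Φ t`
with the witnesses `Θ := 1/(2c)`, `A := C.toReal`, `r := 0`, `K₀ := 0`, `N₀`.  Pointwise
`ofReal (frac_K) ≤ e^{−cK} expVelocityMoment c` (`ofReal_frac_le_expVelocityMoment`); the local Gibbs law is
s-finite and charges only the good set, on which `(z, s) ↦ Φ_s z` is jointly measurable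
(`AdiabatCeiling.aemeasurable_comp_flow_prod₂`), so Tonelli applies and each time slice contributes `≤ C`. -/
theorem farTailAt_of_expVelocityMoment {σ : ℝ} {a₀ θ₀ : T3 → ℝ} {u₀ : T3 → V3} {Φ : Flows σ} {t c : ℝ}
    {C : ℝ≥0∞} {N₀ : ℕ} (hc : 0 < c) (hC : C < ⊤)
    (hmom : ∀ N : ℕ, N₀ ≤ N → ∀ s ∈ Icc 0 t,
      ∫⁻ z, expVelocityMoment c ((Φ N).flow s z) ∂(localGibbsLaw σ a₀ u₀ θ₀ N (Φ N)) ≤ C) :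
    FarTailAt σ a₀ θ₀ u₀ Φ t := by
  refine ⟨1 / (2 * c), C.toReal, 0, 0, by positivity, N₀, fun N hN K _hK => ?_⟩
  set P : Measure (Cfg N) := localGibbsLaw σ a₀ u₀ θ₀ N (Φ N) with hP
  set ν : Measure ℝ := volume.restrict (Icc 0 t) with hν
  -- the law is s-finite (a density against Lebesgue measure) and carried by the good set
  -- adapted from `ShearStressHalfDrudeMarginal.sFinite_localGibbsLaw`
  haveI hXE : SigmaFinite (volume : Measure (T3 × V3)) := inferInstance
  haveI hCfg : SigmaFinite (volume : Measure (Config (N + 1) (Fin 3) T3)) := inferInstance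
  haveI hPs : SFinite P := by
    rw [hP, localGibbsLaw_eq]
    unfold localGibbsMeasure
    infer_instance
  have hgood0 : P (Φ N).goodᶜ = 0 := by
    rw [hP, localGibbsLaw_eq]
    exact (localGibbsMeasure_absolutelyContinuous σ _ _ _ N (Φ N)) (Φ N).measure_compl_good
  -- the observable is measurable, hence a.e.-jointly measurable along the flow
  have hMm : Measurable (fun w : Cfg N => expVelocityMoment c w) := by
    refine (measurable_const.mul (Finset.measurable_sum _ fun i _ => ?_)).ennreal_ofReal
    exact ((measurable_pi_apply i).snd.norm.pow_const 2 |>.const_mul c).exp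
  have hprod : AEMeasurable (fun p : Cfg N × ℝ => expVelocityMoment c ((Φ N).flow p.2 p.1)) (P.prod ν) :=
    AdiabatCeiling.aemeasurable_comp_flow_prod₂ (Φ N) (hMm.comp measurable_fst) hgood0 ν
  -- (1) pointwise Markov under both integrals
  have h1 : ∫⁻ z, (∫⁻ s in Icc 0 t, ENNReal.ofReal (frac K ((Φ N).flow s z))) ∂P ≤
      ENNReal.ofReal (Real.exp (-(c * K))) * ∫⁻ z, ∫⁻ s, expVelocityMoment c ((Φ N).flow s z) ∂ν ∂P := by
    rw [← lintegral_const_mul' _ _ ENNReal.ofReal_ne_top]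
    refine lintegral_mono fun z => ?_
    rw [← lintegral_const_mul' _ _ ENNReal.ofReal_ne_top]
    exact lintegral_mono fun s => ofReal_frac_le_expVelocityMoment hc.le K _
  -- (2) Tonelli
  have h2 : ∫⁻ z, ∫⁻ s, expVelocityMoment c ((Φ N).flow s z) ∂ν ∂P =
      ∫⁻ s, ∫⁻ z, expVelocityMoment c ((Φ N).flow s z) ∂P ∂ν :=
    lintegral_lintegral_swap hprod
  -- (3) each time slice contributes at most `C`
  have h3 : ∫⁻ s, ∫⁻ z, expVelocityMoment c ((Φ N).flow s z) ∂P ∂ν ≤ C * ENNReal.ofReal t := by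
    have hae : ∀ᵐ s ∂ν, ∫⁻ z, expVelocityMoment c ((Φ N).flow s z) ∂P ≤ C := by
      rw [hν, ae_restrict_iff' measurableSet_Icc]
      exact ae_of_all _ fun s hs => hmom N hN s hs
    calc ∫⁻ s, ∫⁻ z, expVelocityMoment c ((Φ N).flow s z) ∂P ∂ν ≤ ∫⁻ _s, C ∂ν := lintegral_mono_ae hae
      _ = C * ENNReal.ofReal t := by
          rw [lintegral_const, hν, Measure.restrict_apply_univ, Real.volume_Icc, sub_zero]
  -- (4) assemble
  calc ∫⁻ z, (∫⁻ s in Icc 0 t, ENNReal.ofReal (frac K ((Φ N).flow s z))) ∂P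
      ≤ ENNReal.ofReal (Real.exp (-(c * K))) * (C * ENNReal.ofReal t) := by
        refine h1.trans ?_
        rw [h2]
        exact mul_le_mul' le_rfl h3
    _ = ENNReal.ofReal (t * C.toReal * ((N : ℝ) + 1) ^ (0 : ℝ) * Real.exp (-(K / (2 * (1 / (2 * c)))))) := by
        have hK : K / (2 * (1 / (2 * c))) = c * K := by
          field_simp
        rw [Real.rpow_zero, mul_one, hK,
          show t * C.toReal * Real.exp (-(c * K)) = Real.exp (-(c * K)) * (C.toReal * t) by ring,
          ENNReal.ofReal_mul (Real.exp_pos _).le, ENNReal.ofReal_mul ENNReal.toReal_nonneg,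
          ENNReal.ofReal_toReal hC.ne]

/-! ## Docks: the registered sub-goal and its literature twin -/

/-- REGISTERED SUB-GOAL `farTail_of_gaussianVelocityTails` of the crux (stub `stub_farTail` of the line
`fibre-deficit-transfer`): **the route item `SpeedCapSurgery.GaussianVelocityTails` (stmt-AtomisticToContinuum-9633)
implies the statement of `stub_farTail` verbatim.**  The landed dock
`AdiabatCeiling.stub_velocityTails_of_gaussianVelocityTails` turns the item into the expected Gaussian moment along
the flow under the crux prefix (horizon `T := t`), and `farTailAt_of_expVelocityMoment` is Markov + Tonelli. -/
theorem farTail_of_gaussianVelocityTails : Summit.AtomisticToContinuum.HydrodynamicLimit.Theses.SpeedCapSurgery.GaussianVelocityTails → ∀ (a₀ θ₀ : T3 → ℝ) (u₀ : T3 → V3), Continuous a₀ → Continuous θ₀ → Continuous u₀ → (∀ x, 0 < a₀ x) → (∀ x, 0 < θ₀ x) → ∃ σ₀ : ℝ, 0 < σ₀ ∧ ∃ η₁ : ℝ, 0 < η₁ ∧ ∀ σ : ℝ, 0 < σ → σ < σ₀ → ∀ (T : ℝ) (ρ θ : ℝ → T3 → ℝ) (u : ℝ → T3 → V3), IsHardSphereEulerSolution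 σ T ρ u θ → ∀ Φ : (N : ℕ) → HardSphereFlow (Torus.geometry (Fin 3)) (hsDiameter σ N) (N + 1), TendstoHydroFieldsAt (fun N => localGibbsLaw σ a₀ u₀ θ₀ N (Φ N)) Φ ρ u θ 0 → ∀ t : ℝ, 0 < t → t < T → (∀ s ∈ Icc 0 t, ∀ x, 2 * ρ s x * σ ^ 3 < η₁) → FarTailAt σ a₀ θ₀ u₀ Φ t := by
  intro h a₀ θ₀ u₀ ha hθ hu ha0 hθ0
  obtain ⟨σ₀, hσ₀, η₁, hη₁, hb⟩ :=
    AdiabatCeiling.stub_velocityTails_of_gaussianVelocityTails h a₀ θ₀ u₀ ha hθ hu ha0 hθ0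
  refine ⟨σ₀, hσ₀, η₁, hη₁, fun σ hσ hσlt T ρ θ u hsol Φ hLLN t ht htT hdil => ?_⟩
  obtain ⟨c, hc, C, hC, N₀, hmom⟩ := hb σ hσ hσlt T ρ θ u hsol Φ hLLN t ht htT hdil
  exact farTailAt_of_expVelocityMoment hc hC hmom

/-- The same conclusion from the literature hypothesis `HighMomentumCutoff σ` for all small `σ`
(Nachtergaele–Yau's Assumption II.1 transcribed to hard spheres, `Literature/Barriers/…/HighMomentumCutoff.lean`;
open, asserted nowhere), through `AdiabatCeiling.velocityTails_of_highMomentumCutoff`. -/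
theorem farTail_of_highMomentumCutoff :
    (∃ σ₀ : ℝ, 0 < σ₀ ∧ ∀ σ : ℝ, 0 < σ → σ < σ₀ → HighMomentumCutoff σ) →
    ∀ (a₀ θ₀ : T3 → ℝ) (u₀ : T3 → V3), Continuous a₀ → Continuous θ₀ → Continuous u₀ →
      (∀ x, 0 < a₀ x) → (∀ x, 0 < θ₀ x) →
      ∃ σ₀ : ℝ, 0 < σ₀ ∧ ∃ η₁ : ℝ, 0 < η₁ ∧ ∀ σ : ℝ, 0 < σ → σ < σ₀ →
        ∀ (T : ℝ) (ρ θ : ℝ → T3 → ℝ) (u : ℝ → T3 → V3), IsHardSphereEulerSolution σ T ρ u θ →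
        ∀ Φ : (N : ℕ) → HardSphereFlow (Torus.geometry (Fin 3)) (hsDiameter σ N) (N + 1),
          TendstoHydroFieldsAt (fun N => localGibbsLaw σ a₀ u₀ θ₀ N (Φ N)) Φ ρ u θ 0 →
          ∀ t : ℝ, 0 < t → t < T → (∀ s ∈ Icc 0 t, ∀ x, 2 * ρ s x * σ ^ 3 < η₁) →
            FarTailAt σ a₀ θ₀ u₀ Φ t := by
  intro h a₀ θ₀ u₀ ha hθ hu ha0 hθ0
  obtain ⟨σ₀, hσ₀, η₁, hη₁, hb⟩ :=
    AdiabatCeiling.velocityTails_of_highMomentumCutoff h a₀ θ₀ u₀ ha hθ hu ha0 hθ0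
  refine ⟨σ₀, hσ₀, η₁, hη₁, fun σ hσ hσlt T ρ θ u hsol Φ hLLN t ht htT hdil => ?_⟩
  obtain ⟨c, hc, C, hC, N₀, hmom⟩ := hb σ hσ hσlt T ρ θ u hsol Φ hLLN t ht htT hdil
  exact farTailAt_of_expVelocityMoment hc hC hmom

/-! ## The equilibrium instance (proved) -/

/-- **`stub_farTail` AT HOMOGENEOUS DATA, for every flow family (PROVED).**  At the profiles `(1, 0, θ₀)`,
`θ₀ > 0` constant: there are `σ₀ > 0` and `η₁ > 0` such that for all `0 < σ < σ₀`, every family of hard-sphere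
flows and every `0 < t < T` (the rest of the crux prefix being idle), `FarTailAt σ 1 θ₀ 0 Φ t` holds (with
`r = 0`): the landed `AdiabatCeiling.velocityTails_homogeneous` gives the expected Gaussian velocity moment along
the flow, and `farTailAt_of_expVelocityMoment` concludes.  This is the equilibrium unit test of the skeleton's
stub 5. -/
theorem farTail_homogeneous :
    ∀ θ₀ : ℝ, 0 < θ₀ →
      ∃ σ₀ : ℝ, 0 < σ₀ ∧ ∃ η₁ : ℝ, 0 < η₁ ∧ ∀ σ : ℝ, 0 < σ → σ < σ₀ →
        ∀ (T : ℝ) (ρ θ : ℝ → T3 → ℝ) (u : ℝ → T3 → V3), IsHardSphereEulerSolution σ T ρ u θ →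
        ∀ Φ : (N : ℕ) → HardSphereFlow (Torus.geometry (Fin 3)) (hsDiameter σ N) (N + 1),
          TendstoHydroFieldsAt
              (fun N => localGibbsLaw σ (fun _ => 1) (fun _ => 0) (fun _ => θ₀) N (Φ N)) Φ ρ u θ 0 →
          ∀ t : ℝ, 0 < t → t < T → (∀ s ∈ Icc 0 t, ∀ x, 2 * ρ s x * σ ^ 3 < η₁) →
            FarTailAt σ (fun _ => 1) (fun _ => θ₀) (fun _ => 0) Φ t := by
  intro θ₀ hθ₀
  obtain ⟨σ₀, hσ₀, η₁, hη₁, hb⟩ := AdiabatCeiling.velocityTails_homogeneous θ₀ hθ₀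
  refine ⟨σ₀, hσ₀, η₁, hη₁, fun σ hσ hσlt T ρ θ u hsol Φ hLLN t ht htT hdil => ?_⟩
  obtain ⟨c, hc, C, hC, N₀, hmom⟩ := hb σ hσ hσlt T ρ θ u hsol Φ hLLN t ht htT hdil
  exact farTailAt_of_expVelocityMoment hc hC hmom

end Summit.AtomisticToContinuum.HydrodynamicLimit.Theorems.FibreDeficitTransfer

end
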